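import Literature.AlgebraicGeometry.HodgeTheory.GriffithsHolomorphicHodgeSubbundlesQP
import Literature.AlgebraicGeometry.HodgeTheory.AlgebraicMonodromyMumfordTateOfQuasiProjective
import Mathlib.Topology.GDelta.Basic
import HarnessLib

/-!
# Off a MEAGRE subset of the base every point is Hodge generic and the algebraic monodromy group lies in
# the Mumford–Tate group — granted only the QUASI-PROJECTIVE form of Griffiths' theorem
# (Deligne 1972 Prop. 7.5 / André 1992 Lemma 4 / CMSP Lemma–Def. 15.3.7; NO Cattani–Deligne–Kaplan)

Family `hodge`, layer `Literature/AlgebraicGeometry/HodgeTheory`. THEOREMS only (no definition, no named fact; the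
print theorem `Griffiths1968_holomorphicHodgeSubbundlesQP` — the end product of the cell's programme
GRIFFITHS-HOLOMORPHY — is a HYPOTHESIS). Written by the prover seat `hodge-nonav-19716-p2` (g12, cell `hodge-nonav`)
for route `HodgeConjecture/SignSymmetricPowers` (crux K1-B `VeryGeneralSignCommutatorsInHg`, stmt-HodgeConjecture-19716),
programme «OFF-MEAGRE-B» (assigned by the route owner hodge-nonav-p3 g35, STATUS 2026-08-29T06:06:24Z).

`HodgeGenericPointsComeagre.isMeagre_setOf_not_isHodgeGenericPoint_of_griffiths1968` /
`exists_isMeagre_isHodgeGenericPoint_of_griffiths1968` (prover-Ax g11) bind the ORIGINAL named fact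
`Griffiths1968_holomorphicHodgeSubbundles` (any smooth projective family over a smooth quasi-projective base).
The cell discharges the QUASI-PROJECTIVE twin `Griffiths1968_holomorphicHodgeSubbundlesQP` (one binder more: the total
space is quasi-projective), whose consumer-facing consequences so far are the countable analytic cover
`exists_countable_analyticCover_not_isHodgeGenericPoint_of_griffiths1968QP` and the CURVE countability twins
(`GriffithsHolomorphicHodgeSubbundlesQP.lean`, seat 20241-p1 g19 after prover-Ax). This file adds the WHOLE-BASE twins:

* `isMeagre_setOf_not_isHodgeGenericPoint_of_griffiths1968QP` — granted the QP fact, the non-Hodge-generic points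
  (`¬ IsHodgeGenericPoint`) of a smooth projective family with quasi-projective total space over a smooth
  quasi-projective base form a MEAGRE set (the sets of the countable analytic cover are nowhere dense;
  `isMeagre_iff_countable_union_isNowhereDense`);
* `exists_isMeagre_isHodgeGenericPoint_of_griffiths1968QP` — consumer form: a meagre `M ⊆ S(ℂ)` off which every
  point is Hodge generic;
* `exists_isMeagre_finiteIndex_le_mumfordTateGroup_of_griffiths1968QP` /
  `exists_isMeagre_algebraicMonodromyGroup_subset_mumfordTateGroup_of_griffiths1968QP` — combined with the PROVED
  Deligne (i) `deligne_finiteIndex_monodromy_le_mumfordTateGroup_of_isQuasiProjectiveOver` (irreducible base): off a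
  meagre `M ⊆ S(ℂ)` a finite-index subgroup of the monodromy group `Γ_s`, and the algebraic monodromy group
  `Mon_s = (Γ_s^Zar)⁰` (`algebraicMonodromyGroup = glIdentityComponent (ratMonodromyGroup …)`), lie in `MT(Hᵏ(X_s))` —
  the ANALYTIC counterpart ("off a meagre set", Deligne 1972 Prop. 7.5: "the complement of some meager subset") of the
  consumer form `cmsp_nonHodgeGenericPoints_countable_algebraic_cover.exists_cover_algebraicMonodromyGroup_subset`
  of the Cattani–Deligne–Kaplan cover ("off countably many proper Zariski-closed subsets").

Honest scope: CONDITIONAL on `Griffiths1968_holomorphicHodgeSubbundlesQP` (flips to unconditional by ONE application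
of a `…QP_holds` theorem); the exceptional set is meagre, NOT shown Lebesgue-null here (the QP fact's chart `ψ` is an
abstract homeomorphism, so only topological smallness transfers) and NOT a countable union of Zariski-closed sets
(that is Cattani–Deligne–Kaplan, print input stmt-HodgeConjecture-23152); nothing here says HC or any rung is proved.

## References

* [Deligne1972WeilK3] P. Deligne, La conjecture de Weil pour les surfaces K3, Invent. Math. 15 (1972), Prop. 7.5.
* [Andre1992] Y. André, Mumford–Tate groups of mixed Hodge structures and the theorem of the fixed part,
  Compositio Math. 82 (1992), §4 Lemma 4.
* [CarlsonMullerStachPeters2017] J. Carlson, S. Müller-Stach, C. Peters, Period Mappings and Period Domains,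
  2nd ed. (2017), Def. 15.3.5, Lemma–Definition 15.3.7.
* [VoisinHodgeI2002] C. Voisin, Hodge Theory and Complex Algebraic Geometry I, CUP (2002), §10.2.1 Thm. 10.3.
* [VoisinHodgeII2003] C. Voisin, Hodge Theory and Complex Algebraic Geometry II (2003), §5.3.1 Lemma 5.13.
-/

noncomputable section

open CategoryTheory AlgebraicGeometry
open _root_.Topology _root_.Filter
open scoped TensorProduct
open Literature.AlgebraicTopology.SingularHomology
open Literature.AlgebraicGeometry.Motives

namespace Literature.AlgebraicGeometry.HodgeTheory

section HodgeTheory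

/-! ### The non-Hodge-generic points are meagre (QP twin) -/

/-- **Granted Griffiths' theorem (QP form), the non-Hodge-generic points of a smooth projective family with
quasi-projective total space over a smooth quasi-projective base form a MEAGRE set** (Deligne 1972 Prop. 7.5 /
André 1992 Lemma 4, analytic form): they lie in a countable union of local analytic hypersurfaces
(`exists_countable_analyticCover_not_isHodgeGenericPoint_of_griffiths1968QP`), each nowhere dense.
[cite: Deligne1972WeilK3, Prop. 7.5] [cite: Andre1992, §4 Lemma 4] [cite: VoisinHodgeI2002, §10.2.1 Thm. 10.3]
[cite: VoisinHodgeII2003, §5.3.1 Lemma 5.13] -/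
theorem isMeagre_setOf_not_isHodgeGenericPoint_of_griffiths1968QP
    (hG : Griffiths1968_holomorphicHodgeSubbundlesQP)
    [HodgeTensorFacts.{0, 0}] {𝒳 S : SchemeOver ℂ} (f : 𝒳 ⟶ S) (n k d : ℕ)
    (hf : IsSmoothProjectiveFamily f n) (hS : IsQuasiProjectiveOver S) (h𝒳 : IsQuasiProjectiveOver 𝒳)
    [AlgebraicGeometry.SmoothOfRelativeDimension d S.hom]
    (hU : IsCohomologicallyLocallyTrivialOn f (Set.univ : Set (ComplexPoints S)))
    (A : ∀ t : ComplexPoints S, HodgeModel n (fiberOver f t)) (hA : ∀ t, (A t).IsHodgeSymmetric)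
    [∀ t, Module.Finite ℚ (singularCohomology ℚ ℚ (ComplexPoints (fiberOver f t)) k)] :
    IsMeagre {t : (Set.univ : Set (ComplexPoints S)) | ¬ IsHodgeGenericPoint f k hU hf A hA t} := by
  obtain ⟨𝒞, h𝒞c, h𝒞s, hcov⟩ :=
    exists_countable_analyticCover_not_isHodgeGenericPoint_of_griffiths1968QP hG f n k d hf hS h𝒳 hU A hA
  rw [isMeagre_iff_countable_union_isNowhereDense]
  exact ⟨𝒞, fun Z hZ ↦ (h𝒞s Z hZ).2, h𝒞c, hcov⟩

/-- **Consumer form** (QP twin of `exists_isMeagre_isHodgeGenericPoint_of_griffiths1968`): granted Griffiths'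
theorem in QP form, there is a MEAGRE subset `M ⊆ S(ℂ)` such that every point off `M` is Hodge generic — "very
general points (complement of a meagre set) are Hodge generic", the analytic counterpart of the Cattani–Deligne–Kaplan
cover `cmsp_nonHodgeGenericPoints_countable_algebraic_cover`. [cite: Deligne1972WeilK3, Prop. 7.5]
[cite: Andre1992, §4 Lemma 4] [cite: VoisinHodgeI2002, §10.2.1 Thm. 10.3] -/
theorem exists_isMeagre_isHodgeGenericPoint_of_griffiths1968QP
    (hG : Griffiths1968_holomorphicHodgeSubbundlesQP)
    [HodgeTensorFacts.{0, 0}] {𝒳 S : SchemeOver ℂ} (f : 𝒳 ⟶ S) (n k d : ℕ)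
    (hf : IsSmoothProjectiveFamily f n) (hS : IsQuasiProjectiveOver S) (h𝒳 : IsQuasiProjectiveOver 𝒳)
    [AlgebraicGeometry.SmoothOfRelativeDimension d S.hom]
    (hU : IsCohomologicallyLocallyTrivialOn f (Set.univ : Set (ComplexPoints S)))
    (A : ∀ t : ComplexPoints S, HodgeModel n (fiberOver f t)) (hA : ∀ t, (A t).IsHodgeSymmetric)
    [∀ t, Module.Finite ℚ (singularCohomology ℚ ℚ (ComplexPoints (fiberOver f t)) k)] :
    ∃ M : Set (ComplexPoints S), IsMeagre M ∧
      ∀ s : (Set.univ : Set (ComplexPoints S)), s.1 ∉ M → IsHodgeGenericPoint f k hU hf A hA s := by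
  refine ⟨Subtype.val '' {t : (Set.univ : Set (ComplexPoints S)) | ¬ IsHodgeGenericPoint f k hU hf A hA t},
    (isMeagre_setOf_not_isHodgeGenericPoint_of_griffiths1968QP hG f n k d hf hS h𝒳 hU A hA).image_val, ?_⟩
  intro s hs
  by_contra h
  exact hs ⟨s, h, rfl⟩

/-! ### Off a meagre set the algebraic monodromy group lies in the Mumford–Tate group (QP, irreducible base) -/

/-- **Off a MEAGRE subset of the base, a finite-index subgroup of the monodromy group and the algebraic monodromy
group lie in the Mumford–Tate group** (Deligne 1972 Prop. 7.5 + CMSP Lemma–Def. 15.3.7 •, analytic form; granted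
Griffiths' theorem in QP form, NO Cattani–Deligne–Kaplan). For a smooth projective family `f : 𝒳 ⟶ S` of relative
dimension `n` with `𝒳` quasi-projective over a smooth quasi-projective IRREDUCIBLE base `S` (smooth of relative
dimension `d`), Hodge-symmetric models `A t` and a degree `k`: there is a meagre `M ⊆ S(ℂ)` such that at every `s ∉ M`
(i) some finite-index subgroup `Γ'` of `Γ_s = ratMonodromyGroup` lies in `MT(Hᵏ(X_s))(ℚ)`, and (ii)
`Mon_s = algebraicMonodromyGroup ⊆ MT(Hᵏ(X_s))(ℚ)`. Proof: the points off the meagre set of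
`exists_isMeagre_isHodgeGenericPoint_of_griffiths1968QP` are Hodge generic, and Deligne (i) is PROVED for families
with quasi-projective total space (`deligne_finiteIndex_monodromy_le_mumfordTateGroup_of_isQuasiProjectiveOver`).
[cite: Deligne1972WeilK3, Prop. 7.5] [cite: CarlsonMullerStachPeters2017, Lemma–Definition 15.3.7]
[cite: Andre1992, §4 Lemma 4] [cite: VoisinHodgeI2002, §10.2.1 Thm. 10.3] -/
theorem exists_isMeagre_finiteIndex_le_mumfordTateGroup_of_griffiths1968QP
    (hG : Griffiths1968_holomorphicHodgeSubbundlesQP)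
    [HodgeTensorFacts.{0, 0}] {𝒳 S : SchemeOver ℂ} (f : 𝒳 ⟶ S) (n k d : ℕ)
    (hf : IsSmoothProjectiveFamily f n) (hS : IsQuasiProjectiveOver S) (h𝒳 : IsQuasiProjectiveOver 𝒳)
    [AlgebraicGeometry.SmoothOfRelativeDimension d S.hom] (hirr : IrreducibleSpace S.left)
    (hU : IsCohomologicallyLocallyTrivialOn f (Set.univ : Set (ComplexPoints S)))
    (A : ∀ t : ComplexPoints S, HodgeModel n (fiberOver f t)) (hA : ∀ t, (A t).IsHodgeSymmetric)
    [∀ t, Module.Finite ℚ (singularCohomology ℚ ℚ (ComplexPoints (fiberOver f t)) k)] :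
    ∃ M : Set (ComplexPoints S), IsMeagre M ∧
      ∀ s : (Set.univ : Set (ComplexPoints S)), s.1 ∉ M →
        (∃ Γ' : Subgroup (singularCohomology ℚ ℚ (ComplexPoints (fiberOver f s.1)) k ≃ₗ[ℚ]
            singularCohomology ℚ ℚ (ComplexPoints (fiberOver f s.1)) k),
          Γ' ≤ ratMonodromyGroup f k hU s ∧ (Γ'.subgroupOf (ratMonodromyGroup f k hU s)).FiniteIndex ∧
            Γ' ≤ ((A s.1).hodgeStructure (hf.isSmoothProjective s.1) (hA s.1) k).mumfordTateGroup) ∧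
        algebraicMonodromyGroup f k hU s ⊆
          ((A s.1).hodgeStructure (hf.isSmoothProjective s.1) (hA s.1) k).mumfordTateGroup := by
  obtain ⟨M, hM, hgen⟩ := exists_isMeagre_isHodgeGenericPoint_of_griffiths1968QP hG f n k d hf hS h𝒳 hU A hA
  have hSs : Smooth S.hom := AlgebraicGeometry.SmoothOfRelativeDimension.smooth d _
  exact ⟨M, hM, fun s hs ↦ deligne_finiteIndex_monodromy_le_mumfordTateGroup_of_isQuasiProjectiveOver f n k hf
    h𝒳 hS hSs hirr hU A hA s (hgen s hs)⟩

/-- **Off a MEAGRE subset of the base the algebraic monodromy group lies in the Mumford–Tate group** — the clause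
(ii) of `exists_isMeagre_finiteIndex_le_mumfordTateGroup_of_griffiths1968QP` in the shape consumers use
(`algebraicMonodromyGroup f k hU s = glIdentityComponent (ratMonodromyGroup f k hU s) ⊆ MT(Hᵏ(X_s))`); the analytic
twin of `cmsp_nonHodgeGenericPoints_countable_algebraic_cover.exists_cover_algebraicMonodromyGroup_subset`.
[cite: Deligne1972WeilK3, Prop. 7.5] [cite: CarlsonMullerStachPeters2017, Lemma–Definition 15.3.7]
[cite: VoisinHodgeI2002, §10.2.1 Thm. 10.3] -/
theorem exists_isMeagre_algebraicMonodromyGroup_subset_mumfordTateGroup_of_griffiths1968QP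
    (hG : Griffiths1968_holomorphicHodgeSubbundlesQP)
    [HodgeTensorFacts.{0, 0}] {𝒳 S : SchemeOver ℂ} (f : 𝒳 ⟶ S) (n k d : ℕ)
    (hf : IsSmoothProjectiveFamily f n) (hS : IsQuasiProjectiveOver S) (h𝒳 : IsQuasiProjectiveOver 𝒳)
    [AlgebraicGeometry.SmoothOfRelativeDimension d S.hom] (hirr : IrreducibleSpace S.left)
    (hU : IsCohomologicallyLocallyTrivialOn f (Set.univ : Set (ComplexPoints S)))
    (A : ∀ t : ComplexPoints S, HodgeModel n (fiberOver f t)) (hA : ∀ t, (A t).IsHodgeSymmetric)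
    [∀ t, Module.Finite ℚ (singularCohomology ℚ ℚ (ComplexPoints (fiberOver f t)) k)] :
    ∃ M : Set (ComplexPoints S), IsMeagre M ∧
      ∀ s : (Set.univ : Set (ComplexPoints S)), s.1 ∉ M →
        glIdentityComponent (ratMonodromyGroup f k hU s) ⊆
          ((A s.1).hodgeStructure (hf.isSmoothProjective s.1) (hA s.1) k).mumfordTateGroup := by
  obtain ⟨M, hM, h⟩ :=
    exists_isMeagre_finiteIndex_le_mumfordTateGroup_of_griffiths1968QP hG f n k d hf hS h𝒳 hirr hU A hA
  exact ⟨M, hM, fun s hs ↦ (h s hs).2⟩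

end HodgeTheory

end Literature.AlgebraicGeometry.HodgeTheory

end
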